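import Summits.BirchSwinnertonDyer.BirchSwinnertonDyer.Theorems.ManinLocalTwoThreeManinPrimeToThreeAtNineInhabited
import Literature.NumberTheory.EllipticCurves.HeckeThetaCMNewformGamma0Holds
import Literature.NumberTheory.EllipticCurves.SexticTwistHeckeCoefficientsGoodTwo
import Literature.NumberTheory.EllipticCurves.MordellCurveTorsionDividesSix
import Literature.NumberTheory.EllipticCurves.LFunctionSmulProofs
import Literature.NumberTheory.EllipticCurves.TwistedLValueSeries
import Literature.NumberTheory.LFunctions.RayClassOfIdealHom
import Literature.NumberTheory.EllipticCurves.KubertTateFiveEisensteinTwist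
import Mathlib.Tactic.NormNum.LegendreSymbol
import HarnessLib

/-!
# `27a3 : y² + y = x³` is modular by HECKE'S THETA SERIES of `ℚ(ω)` mod `(3)`, FACT-FREE; `η(3τ)²η(9τ)²` is its newform;
# C3's hypothesis type is inhabited UNCONDITIONALLY at `N = 27 = 3³`
(route `ManinLocalTwoThree`, crux C3 `ManinPrimeToThreeAtNine` stmt-BirchSwinnertonDyer-22968, rung stmt-…-22445; cell bsd-f2-manin;
AUTHORED by planner -an g48 (TURNKEY T-an-g48-1 = HOME/an/g48/Sketch-an-g48.lean sha16 757f892d7f9cceec, §0–§5, §7–§8; MEMO-an §93),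
landed def-free and composed with the `N = 27` scaffolding (`NonVacuityTwentySeven`, `LevelTwentySeven`) by prover seat p3 gen 22;
`--supports stmt-BirchSwinnertonDyer-22968`)

Everything is assembled from PROVED tree theorems — no named fact, no CDT, no Wiles/BCDT, no hypothesis:

* §1 (H0) the CM Größencharakter `𝔭 ↦ e(ϖ_𝔭)` of `ℚ(ω)` mod `(3)` (`isGrossencharakter_primaryGen` + `exists/eq units … span_three`);
* §2 (H2) trivial Nebentypus `ψ̃((n)) = χ₋₃(n)·n`; §3 (H3) the bridge `rayClassCoeff (3) ψ 𝔞 = ν₁(𝔞) e(ϖ_𝔞)` to ★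
  `SexticTwist.lFunction_eq_jacobiSym_mul_sum_of_eq_sixteen_mul` (`u = 1`) and `⟨2,0,0,4⟩ • (y² = x³ + 16) = 27a3` (`LFunction_smul`);
* §4 (H1 = Hecke 1926 / Ribet 1977 §3, tree `HeckeTheta.heckeThetaCuspForm_of_isGrossencharakter` at `K3`, `k = 2`, `𝔪 = (3)`): **a cusp form on
  `Γ₀(|d_K|·N𝔪) = Γ₀(27)` with `q`-expansion `Σ_{(𝔞,3)=1} ϖ_𝔞 q^{N𝔞}`** (`exists_heckeTheta_twentySeven`);
* §5 (H3/H4) **`existsNewform_twentySevenA3 : ∃ g ∈ S₂(Γ₀(27)), IsNewformOf 27a3 g` FACT-FREE**, and — composing with p3's `NonVacuityTwentySeven`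
  (`S₂(Γ₀(27))` is the line of `η(3τ)²η(9τ)²`, the only newform of level `27`) — **`isNewformOf_twentySevenA3_etaProduct : IsNewformOf 27a3 (η(3τ)²η(9τ)²)`**
  and the classical identity **`aₙ(η(3τ)²η(9τ)²) = Σ_{N𝔞=n, (𝔞,3)=1} ϖ_𝔞 = aₙ(27a3)`** for all `n` (`cuspCoeff_etaProductTwentySeven_eq_heckeSum`,
  `…_eq_lFunction_twentySevenA3`), kernel-checked with no printed input;
* §6 **THE WITNESS (UNCONDITIONAL): a lattice-optimal `X₀(27)`-datum on a global minimal model in the class `27a`** (p3's plug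
  `NonVacuityTwentySeven.exists_latticeOptimalDatum_twentySeven_of_cuspCoeff_eq` discharged) — after `32 = 2⁵` and `288` (p2 g24) the first inhabitant with
  `27 ∣ N`; C3's binder block `maninPrimeToThreeAtNine_domain_inhabited_twentySeven`; modularity of `27a3` at its conductor level (`LevelTwentySeven.
  conductorNorm_twentySevenA3`; -an's second conductor engine `TameUpperUnitTwistRecords.conductorNorm_eq_of_exponents` is in the Sketch, not re-landed);
* §7 the route's conditional statements SAY SOMETHING at `27 ∣ N`: item C3 (+ its four binders) ⟹ `3 ∤ c₀`; the rung ⟹ `|c₀| = 1`; CDT ALONE ⟹ `3 ∤ c₀`.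

HONEST FRAMING: §1–§6 unconditional (standard axioms); §7 CONDITIONAL on the item statements resp. on CDT (printed, statement-only).  Nothing here
computes `c₀(27a)` unconditionally, proves C3, Manin's conjecture or BSD; the items stay OPEN as filed.  No definition, no named fact, no sorry.
BC5 data witness (an g48): HOME/an/g48/census27-B2000.txt — four engines (η-product / Hecke sum / theta / curve) agree for `n ≤ 2000`, 0 mismatches.
[cite: Hecke1926Modulfunktionen] [cite: Ribet1977Nebentypus, §3] [cite: IrelandRosen1990, Ch. 18 §7] [cite: Koehler2011, §1] [cite: CremonaAlgorithms1997, Table 1 (27a3), Table 3]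
[cite: EdixhovenManin1991, Prop. 2] [cite: CalegariDimitrovTang2025, Thm. 1]
-/

set_option autoImplicit false
-- lint-debt: the directory name repeats the summit name (sibling precedent `ManinLocalTwoThreeManinPrimeToThreeAtNineInhabited.lean`)
set_option linter.dupNamespace false

noncomputable section

open scoped Classical ComplexConjugate MatrixGroups UpperHalfPlane ModularForm Real
open Complex NumberField IsDedekindDomain Finset CongruenceSubgroup
open Literature.NumberTheory.NumberFields Literature.NumberTheory.NumberFields.K3
open Literature.NumberTheory.GaloisRepresentations
open Literature.NumberTheory.LFunctions Literature.NumberTheory.LFunctions.NumberField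
open Literature.NumberTheory.LFunctions.EisensteinGrossen Literature.NumberTheory.LFunctions.PlaneLattice
open Literature.NumberTheory.EllipticCurves Literature.NumberTheory.EllipticCurves.ModularForms
open Literature.NumberTheory.EllipticCurves.SexticTwist Literature.NumberTheory.EllipticCurves.MordellTorsion
open Literature.NumberTheory.Automorphic

namespace Summit.BirchSwinnertonDyer.BirchSwinnertonDyer.Theorems.ManinLocalTwoThree.HeckeThetaTwentySeven

/-! ## §0 The curve `27a3 : y² + y = x³` -/

/-- `⟨2, 0, 0, 4⟩ • (y² = x³ + 16) = 27a3 = [0,0,1,0,0]` (tree `variableChange_mordellCurve_sixteen`). [cite: CremonaAlgorithms1997, Table 1 (27a3)] -/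
theorem smul_mordellCurve_sixteen_eq_twentySevenA3 :
    (⟨Units.mk0 (2 : ℚ) two_ne_zero, 0, 0, 4⟩ : WeierstrassCurve.VariableChange ℚ) • mordellCurve (16 : ℚ) = (⟨0, 0, 1, 0, 0⟩ : WeierstrassCurve ℚ) := by
  have h := variableChange_mordellCurve_sixteen (F := ℚ) two_ne_zero (0 : ℚ)
  rw [show (16 : ℚ) * (4 * 0 + 1) = 16 by norm_num] at h
  exact h

/-! ## §1 The Eisenstein field data at modulus `(3)` (H0) -/

-- `d_{ℚ(ω)} = −3` on the tree's model `K3` is the tree's `KubertTateEisensteinTwist.discr_K3` (not restated).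

/-- `N((3)) = 9` in `ℤ[ω]`. [folklore] -/
theorem absNorm_three : Ideal.absNorm (three : Ideal (𝓞 K3)) = 9 := by
  have h := absNorm_span_natCast 3
  have e : (((3 : ℕ) : ℤ) : 𝓞 K3) = 3 := by push_cast; rfl
  rw [e] at h
  simpa using h

/-- The level `|d_K| · N𝔪 = 3 · 9 = 27`. [cite: Ribet1977Nebentypus, §3] -/
theorem level_twentySeven : (NumberField.discr K3).natAbs * Ideal.absNorm (three : Ideal (𝓞 K3)) = 27 := by
  rw [KubertTateEisensteinTwist.discr_K3, absNorm_three]; rfl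

/-- `ℚ(ω)` is totally complex. [folklore] -/
theorem isTotallyComplex_K3 : IsTotallyComplex K3 :=
  IsCyclotomicExtension.Rat.isTotallyComplex K3 (n := 3) (by norm_num)

/-- `(3) ≠ 0`. [folklore] -/
theorem three_ne_bot : (three : Ideal (𝓞 K3)) ≠ ⊥ := by
  rw [Ne, Ideal.span_singleton_eq_bot]; norm_num

/-- Every residue class prime to `(3)` contains a unit of `ℤ[ω]` … (tree `exists_units_mul_sub_one_mem_span_three`). [cite: IrelandRosen1990, Ch. 9 §3] -/
theorem hsurj27 : ∀ x : 𝓞 K3, IsCoprime (Ideal.span {x}) three → ∃ u : (𝓞 K3)ˣ, (u : 𝓞 K3) * x - 1 ∈ three :=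
  exists_units_mul_sub_one_mem_span_three hζ

/-- … and exactly one (tree `units_eq_one_of_sub_one_mem_span_three`). [cite: IrelandRosen1990, Ch. 9 §3] -/
theorem hinj27 : ∀ u : (𝓞 K3)ˣ, (u : 𝓞 K3) - 1 ∈ three → u = 1 :=
  units_eq_one_of_sub_one_mem_span_three hζ

/-- The embedding `e = embC : K3 → ℂ` as a ring map, evaluated. [folklore] -/
theorem embC_toRingHom_apply (x : K3) : ((embC : K3 →ₐ[ℚ] ℂ).toRingHom : K3 →+* ℂ) x = embC x := rfl

/-- **H0 (PROVED, tree): the CM Größencharakter of `27a`**, `𝔭 ↦ e(ϖ_𝔭)` with `ϖ_𝔭 ≡ 1 (mod 3)` the primary generator (`𝔭 ∤ 3`), is a Größencharakter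
modulo `(3)` of type `(embType e, embTypeConj e)`. [cite: Hecke1926Modulfunktionen] [cite: IrelandRosen1990, Ch. 18 §7] -/
theorem isGrossencharakter_psi27 :
    IsGrossencharakter three (embType (embC : K3 →ₐ[ℚ] ℂ).toRingHom) (embTypeConj (embC : K3 →ₐ[ℚ] ℂ).toRingHom)
      (fun v ↦ (embC : K3 →ₐ[ℚ] ℂ).toRingHom (primaryGen hsurj27 v)) :=
  isGrossencharakter_primaryGen hsurj27 hinj27 three_ne_bot _

/-! ## §2 The Nebentypus check `ψ̃((n)) = χ₋₃(n) · n` (H2) -/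

/-- `(−3/n) = +1, −1` according as `n ≡ 1, 2 (mod 3)` (`n` odd, `3 ∤ n`). [folklore] -/
theorem jacobiSym_neg_three_eq {n : ℕ} (hn : Odd n) (h3 : ¬ 3 ∣ n) :
    jacobiSym (-3) n = if n % 3 = 1 then 1 else -1 := by
  have hn4 : n % 4 = 1 ∨ n % 4 = 3 := by obtain ⟨k, rfl⟩ := hn; omega
  have key : jacobiSym (-3) n = jacobiSym n 3 := by
    have e : (-3 : ℤ) = -((3 : ℕ) : ℤ) := by norm_num
    rw [e, jacobiSym.neg _ hn]
    rcases hn4 with h | h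
    · rw [ZMod.χ₄_nat_one_mod_four h, one_mul, jacobiSym.quadratic_reciprocity_one_mod_four' (by decide) h]
    · rw [ZMod.χ₄_nat_three_mod_four h, jacobiSym.quadratic_reciprocity_three_mod_four (by decide) h]
      ring
  rw [key]
  by_cases h : n % 3 = 1
  · rw [if_pos h, jacobiSym.mod_left' (a₂ := 1) (by omega)]
    norm_num
  · rw [if_neg h, jacobiSym.mod_left' (a₂ := 2) (by omega)]
    norm_num

/-- `(n) + (3) = 1` in `ℤ[ω]` for `3 ∤ n`. [folklore] -/
theorem isCoprime_span_natCast_three {n : ℕ} (h3 : ¬ 3 ∣ n) :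
    IsCoprime (Ideal.span {(n : 𝓞 K3)}) three := by
  rw [Ideal.isCoprime_span_singleton_iff]
  have hc : n.Coprime 3 := (Nat.coprime_comm).mp ((Nat.Prime.coprime_iff_not_dvd Nat.prime_three).mpr h3)
  have h : IsCoprime ((n : ℕ) : ℤ) ((3 : ℕ) : ℤ) := Nat.isCoprime_iff_coprime.mpr hc
  simpa using h.map (Int.castRingHom (𝓞 K3))

/-- `primarize n = n` or `−n` according as `n ≡ 1, 2 (mod 3)`. [cite: IrelandRosen1990, Ch. 9 §3] -/
theorem primarize_natCast {n : ℕ} (h3 : ¬ 3 ∣ n) :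
    primarize hsurj27 (n : 𝓞 K3) = if n % 3 = 1 then (n : 𝓞 K3) else -(n : 𝓞 K3) := by
  have hcop := isCoprime_span_natCast_three h3
  split_ifs with h
  · refine primarize_eq_of hsurj27 hinj27 hcop rfl ?_
    obtain ⟨k, hk⟩ : ∃ k, n = 3 * k + 1 := ⟨n / 3, by omega⟩
    exact Ideal.mem_span_singleton.mpr ⟨k, by rw [hk]; push_cast; ring⟩
  · have h2 : n % 3 = 2 := by omega
    refine primarize_eq_of hsurj27 hinj27 hcop (Ideal.span_singleton_neg (n : 𝓞 K3)) ?_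
    obtain ⟨k, hk⟩ : ∃ k, n = 3 * k + 2 := ⟨n / 3, by omega⟩
    exact Ideal.mem_span_singleton.mpr ⟨-(k + 1), by rw [hk]; push_cast; ring⟩

/-- **H2 (PROVED): trivial Nebentypus** — `ψ̃((n)) = χ₋₃(n) n` for odd `n` prime to `27`. [cite: Ribet1977Nebentypus, §3] -/
theorem nebentypus27 (n : ℕ) (hn : Odd n) (hc : n.Coprime 27) :
    idealPow K3 (fun v ↦ (embC : K3 →ₐ[ℚ] ℂ).toRingHom (primaryGen hsurj27 v)) (Ideal.span {(n : 𝓞 K3)}) =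
      (jacobiSym (-3) n : ℂ) * (n : ℂ) := by
  have h3 : ¬ 3 ∣ n := by
    intro h
    have h9 : (3 : ℕ) ∣ Nat.gcd n 27 := Nat.dvd_gcd h (by norm_num)
    rw [hc] at h9
    exact absurd h9 (by norm_num)
  have hn0 : (n : 𝓞 K3) ≠ 0 := by
    have : n ≠ 0 := by rintro rfl; exact h3 (dvd_zero 3)
    exact_mod_cast this
  have hcop := isCoprime_span_natCast_three h3
  have h := idealPow_primaryGen_span hsurj27 hinj27 three_ne_bot (embC : K3 →ₐ[ℚ] ℂ).toRingHom hn0 hcop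
  rw [show idealPow K3 (fun v ↦ (embC : K3 →ₐ[ℚ] ℂ).toRingHom (primaryGen hsurj27 v)) (Ideal.span {(n : 𝓞 K3)}) =
      (embC : K3 →ₐ[ℚ] ℂ).toRingHom (primarize hsurj27 (n : 𝓞 K3)) from h,
    primarize_natCast h3, jacobiSym_neg_three_eq hn h3]
  split_ifs <;> simp

/-! ## §3 The coefficient bridge `rayClassCoeff (3) ψ = ν₁ · e(ϖ)` (H3; ★'s weight at `u = 1`) -/

/-- The cubic symbol `(1/𝔞)₃` is trivial. [folklore] -/
theorem psi_one (I : Ideal (𝓞 K3)) : EisensteinGrossen.psi (1 : 𝓞 K3) I = 1 := by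
  unfold EisensteinGrossen.psi EisensteinGrossen.psiLoc
  rw [dif_neg (by push Not; exact ⟨1, by simp⟩)]
  exact artinSymbol_const_one I

/-- `ν₁(𝔞) = 1` on ideals prime to `3`, `0` otherwise. [folklore] -/
theorem grossenNu_one_apply (I : Ideal (𝓞 K3)) :
    grossenNu (1 : 𝓞 K3) 1 0 I = if Adm (1 : 𝓞 K3) I then 1 else 0 := by
  rw [grossenNu_apply]
  split_ifs with h
  · rw [psi_one, Units.val_one, one_pow, one_mul, sectorWeight, pow_zero]
  · rfl

/-- Admissibility at `u = 1` is `𝔞 ≠ 0 ∧ (𝔞, 3) = 1`. [folklore] -/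
theorem adm_one_iff (I : Ideal (𝓞 K3)) : Adm (1 : 𝓞 K3) I ↔ I ≠ ⊥ ∧ IsCoprime I three := by
  simp [Adm, three]

/-- **H3 (PROVED): `rayClassCoeff (3) ψ 𝔞 = ν₁(𝔞) · e(ϖ_𝔞)` for every ideal `𝔞`**. [cite: Hecke1926Modulfunktionen] [cite: IrelandRosen1990, Ch. 18 §7] -/
theorem rayClassCoeff_psi27 (I : Ideal (𝓞 K3)) :
    rayClassCoeff three (fun v ↦ (embC : K3 →ₐ[ℚ] ℂ).toRingHom (primaryGen hsurj27 v)) I =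
      grossenNu (1 : 𝓞 K3) 1 0 I * embC (primGen I : K3) := by
  rw [grossenNu_one_apply]
  unfold rayClassCoeff
  by_cases h : I ≠ ⊥ ∧ IsCoprime I three
  · obtain ⟨hI0, hIc⟩ := h
    rw [if_pos ⟨hI0, hIc⟩, if_pos ((adm_one_iff I).mpr ⟨hI0, hIc⟩), one_mul]
    obtain ⟨b, hb⟩ := (IsPrincipalIdealRing.principal I).principal
    have hbI : Ideal.span {b} = I := by rw [hb]
    have hb0 : b ≠ 0 := by
      rintro rfl
      exact hI0 (by rw [← hbI, Ideal.span_singleton_eq_bot])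
    have hbc : IsCoprime (Ideal.span {b}) three := by rwa [hbI]
    rw [← hbI, show idealPow K3 (fun v ↦ (embC : K3 →ₐ[ℚ] ℂ).toRingHom (primaryGen hsurj27 v)) (Ideal.span {b}) =
        (embC : K3 →ₐ[ℚ] ℂ).toRingHom (primarize hsurj27 b) from
      idealPow_primaryGen_span hsurj27 hinj27 three_ne_bot (embC : K3 →ₐ[ℚ] ℂ).toRingHom hb0 hbc,
      primGen_eq_of hbc (span_primarize hsurj27 hbc) (primarize_sub_one_mem hsurj27 hbc), embC_toRingHom_apply]
  · rw [if_neg h, if_neg (fun hA ↦ h ((adm_one_iff I).mp hA)), zero_mul]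

/-! ## §4 Hecke's theta series at level `27` (H1, K1) -/

/-- Transport of a `q`-series presentation along propositional equalities of level and weight. [folklore] -/
theorem transportLevel {L : ℕ} {k : ℤ} (hL : L = 27) (hk : k = 2) (c : ℕ → ℂ) (g : CuspForm (Gamma0 L) k)
    (hg : ∀ τ : ℍ, HasSum (fun n : ℕ ↦ c n * cexp (2 * π * I * (τ : ℂ)) ^ n) (g τ)) :
    ∃ g' : CuspForm (Gamma0 27) 2, ∀ τ : ℍ, HasSum (fun n : ℕ ↦ c n * cexp (2 * π * I * (τ : ℂ)) ^ n) (g' τ) := by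
  subst hL hk; exact ⟨g, hg⟩

/-- **H1 (PROVED, tree theorem `HeckeTheta.heckeThetaCuspForm_of_isGrossencharakter` at `K3`, `k = 2`, `𝔪 = (3)`)**: Hecke's theta series
`Σ_{(𝔞,3)=1} ψ̃(𝔞) q^{N𝔞}` is a weight-2 cusp form on `Γ₀(27)`. [cite: Hecke1926Modulfunktionen] [cite: Ribet1977Nebentypus, §3] -/
theorem exists_heckeTheta27_hasSum :
    ∃ g : CuspForm (Gamma0 27) 2, ∀ τ : ℍ,
      HasSum (fun n : ℕ ↦ (∑ᶠ J ∈ {J : Ideal (𝓞 K3) | Ideal.absNorm J = n},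
        rayClassCoeff three (fun v ↦ (embC : K3 →ₐ[ℚ] ℂ).toRingHom (primaryGen hsurj27 v)) J) *
        cexp (2 * π * I * (τ : ℂ)) ^ n) (g τ) := by
  have hG : IsGrossencharakter three (fun w ↦ (((2 : ℕ) : ℤ) - 1) * embType (embC : K3 →ₐ[ℚ] ℂ).toRingHom w)
      (fun w ↦ (((2 : ℕ) : ℤ) - 1) * embTypeConj (embC : K3 →ₐ[ℚ] ℂ).toRingHom w)
      (fun v ↦ (embC : K3 →ₐ[ℚ] ℂ).toRingHom (primaryGen hsurj27 v)) := by
    have e1 : (fun w ↦ (((2 : ℕ) : ℤ) - 1) * embType (embC : K3 →ₐ[ℚ] ℂ).toRingHom w) = embType (embC : K3 →ₐ[ℚ] ℂ).toRingHom :=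
      funext fun w ↦ by norm_num
    have e2 : (fun w ↦ (((2 : ℕ) : ℤ) - 1) * embTypeConj (embC : K3 →ₐ[ℚ] ℂ).toRingHom w) = embTypeConj (embC : K3 →ₐ[ℚ] ℂ).toRingHom :=
      funext fun w ↦ by norm_num
    rw [e1, e2]; exact isGrossencharakter_psi27
  have hneb : ∀ n : ℕ, Odd n → n.Coprime ((discr K3).natAbs * Ideal.absNorm three) →
      idealPow K3 (fun v ↦ (embC : K3 →ₐ[ℚ] ℂ).toRingHom (primaryGen hsurj27 v)) (Ideal.span {(n : 𝓞 K3)}) =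
        (jacobiSym (discr K3) n : ℂ) * (n : ℂ) ^ (2 - 1) := by
    intro n hn hc
    rw [level_twentySeven] at hc
    rw [KubertTateEisensteinTwist.discr_K3, show (2 : ℕ) - 1 = 1 from rfl, pow_one]
    exact nebentypus27 n hn hc
  obtain ⟨g, hg⟩ := Literature.NumberTheory.EllipticCurves.ModularForms.HeckeTheta.heckeThetaCuspForm_of_isGrossencharakter
    K3 K3.finrank_eq isTotallyComplex_K3 (embC : K3 →ₐ[ℚ] ℂ).toRingHom 2 le_rfl even_two three three_ne_bot _ hG hneb
  exact transportLevel level_twentySeven (by norm_num) _ g hg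

/-- Fourier coefficients of a form on `Γ₀(27)` from a `q`-series `HasSum`. [folklore] -/
theorem cuspCoeff_eq_of_hasSum_twentySeven (g : CuspForm (Gamma0 27) 2) (c : ℕ → ℂ)
    (hg : ∀ τ : ℍ, HasSum (fun n : ℕ ↦ c n * cexp (2 * π * I * (τ : ℂ)) ^ n) (g τ)) (n : ℕ) :
    cuspCoeff g n = c n := by
  show (UpperHalfPlane.qExpansion 1 ⇑g).coeff n = c n
  refine Literature.NumberTheory.ModularForms.qExpansion_coeff_eq_of_hasSum (c := c)
    (SlashInvariantFormClass.periodic_comp_ofComplex g (one_mem_strictPeriods_Gamma0 (N := 27)))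
    (ModularFormClass.holo g) (ModularFormClass.bdd_at_infty g) (fun τ ↦ ?_) n
  refine (hg τ).congr_fun fun m ↦ ?_
  rw [smul_eq_mul, Function.Periodic.qParam]
  congr 2
  push_cast
  ring_nf

/-- The ray-class coefficient sum IS ★'s Hecke sum `Σ_{N𝔞 = n} ν₁(𝔞) e(ϖ_𝔞)`. [cite: IrelandRosen1990, Ch. 18 §7] -/
theorem finsum_rayClassCoeff_eq_heckeSum27 (n : ℕ) :
    ∑ᶠ J ∈ {J : Ideal (𝓞 K3) | Ideal.absNorm J = n}, rayClassCoeff three (fun v ↦ (embC : K3 →ₐ[ℚ] ℂ).toRingHom (primaryGen hsurj27 v)) J =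
      ∑ I ∈ idealsOfNorm K3 n, grossenNu (1 : 𝓞 K3) 1 0 I * embC (primGen I : K3) := by
  rw [finsum_mem_eq_finite_toFinset_sum _ (Ideal.finite_setOf_absNorm_eq n)]
  refine Finset.sum_congr (Finset.ext fun J ↦ ?_) fun J _ ↦ rayClassCoeff_psi27 J
  rw [Set.Finite.mem_toFinset, mem_idealsOfNorm, Set.mem_setOf_eq]

/-- **K1 PROVED (fact-free): Hecke's theta series `Σ ϖ_𝔞 q^{N𝔞}` of `ℚ(ω)` mod `(3)` is a cusp form of weight `2` on `Γ₀(27)` with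
`aₙ = Σ_{N𝔞 = n} ν₁(𝔞) e(ϖ_𝔞)`.** [cite: Hecke1926Modulfunktionen] [cite: Ribet1977Nebentypus, §3] -/
theorem exists_heckeTheta_twentySeven :
    ∃ g : CuspForm (Gamma0 27) 2, ∀ n : ℕ, cuspCoeff g n = ∑ I ∈ idealsOfNorm K3 n, grossenNu (1 : 𝓞 K3) 1 0 I * embC (primGen I : K3) := by
  obtain ⟨g, hg⟩ := exists_heckeTheta27_hasSum
  exact ⟨g, fun n ↦ (cuspCoeff_eq_of_hasSum_twentySeven g _ hg n).trans (finsum_rayClassCoeff_eq_heckeSum27 n)⟩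

/-! ## §5 `aₙ(g) = aₙ(27a3)`; the newform IS `η(3τ)²η(9τ)²` (H3/H4 + p3's `NonVacuityTwentySeven`) -/

/-- **H3 (PROVED): `aₙ(27a3) = Σ_{N𝔞 = n} ν₁(𝔞) e(ϖ_𝔞)`** (★ `lFunction_eq_jacobiSym_mul_sum_of_eq_sixteen_mul` at `u = 1` + `LFunction_smul`).
[cite: IrelandRosen1990, Ch. 18 §7] -/
theorem lFunction_twentySevenA3_eq_heckeSum (n : ℕ) :
    (((⟨0, 0, 1, 0, 0⟩ : WeierstrassCurve ℚ).LFunction n : ℤ) : ℂ) = ∑ I ∈ idealsOfNorm K3 n, grossenNu (1 : 𝓞 K3) 1 0 I * embC (primGen I : K3) := by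
  have h6 : ∀ q : ℕ, q.Prime → ¬ (q : ℤ) ^ 6 ∣ (16 : ℤ) := by
    intro q hq h
    have h2 : (2 : ℤ) ^ 6 ≤ (q : ℤ) ^ 6 := pow_le_pow_left₀ (by norm_num) (by exact_mod_cast hq.two_le) 6
    have := Int.le_of_dvd (by norm_num) h
    omega
  have h := lFunction_eq_jacobiSym_mul_sum_of_eq_sixteen_mul (k := 16) (u := 1) (by norm_num) (by norm_num) h6 n
  simp only [jacobiSym.one_left, Int.cast_one, one_mul, Int.cast_ofNat] at h
  haveI := isElliptic_mordellCurve (F := ℚ) (D := 16) (by norm_num)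
  rw [← h, ← smul_mordellCurve_sixteen_eq_twentySevenA3, WeierstrassCurve.LFunction_smul]

/-- `a₁ = 1` for the Hecke sum (the unit ideal). [folklore] -/
theorem heckeSum27_one : ∑ I ∈ idealsOfNorm K3 1, grossenNu (1 : 𝓞 K3) 1 0 I * embC (primGen I : K3) = 1 := by
  rw [idealsOfNorm_one, Finset.sum_singleton, primGen_top, show (⊤ : Ideal (𝓞 K3)) = 1 from Ideal.one_eq_top.symm, map_one]
  simp

/-- **E-an-g48-1 PROVED (fact-free): `27a3` is modular by a newform of level `27`** — `∃ g ∈ S₂(Γ₀(27)), IsNewformOf 27a3 g`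
(new: no forms at levels `1, 3, 9`; eigen: `dim S₂(Γ₀(27)) = 1`; `a₁ = 1`; `aₙ(g) = aₙ(27a3)`). [cite: Hecke1926Modulfunktionen] [cite: IrelandRosen1990, Ch. 18 §7] -/
theorem existsNewform_twentySevenA3 : ∃ g : CuspForm (Gamma0 27) 2, IsNewformOf (⟨0, 0, 1, 0, 0⟩ : WeierstrassCurve ℚ) g := by
  obtain ⟨g, hg⟩ := exists_heckeTheta_twentySeven
  have h1 : cuspCoeff g 1 = 1 := by rw [hg, heckeSum27_one]
  have hne : g ≠ 0 := by
    intro h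
    have h0 : cuspCoeff ((0 : ℂ) • g) 1 = 0 := by rw [cuspCoeff_smul, zero_mul]
    rw [zero_smul, ← h, h1] at h0
    exact one_ne_zero h0
  exact ⟨g, ⟨NonVacuityTwentySeven.mem_newSubspace0_twentySeven g, NonVacuityTwentySeven.isHeckeEigenform_of_ne_zero_twentySeven hne, h1⟩,
    fun n ↦ by rw [hg, lFunction_twentySevenA3_eq_heckeSum]⟩

/-- **`aₙ(η(3τ)²η(9τ)²) = aₙ(27a3)` for ALL `n`, FACT-FREE** (the newform of §5 is a newform of level `27`, hence `η(3τ)²η(9τ)²` by p3's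
`eq_etaProductTwentySeven_of_isNewform0`).  This is the hypothesis of `NonVacuityTwentySeven.exists_latticeOptimalDatum_twentySeven_of_cuspCoeff_eq`,
now a theorem. [cite: Koehler2011, §1] [cite: CremonaAlgorithms1997, Table 3 (N = 27)] -/
theorem cuspCoeff_etaProductTwentySeven_eq_lFunction_twentySevenA3 (n : ℕ) :
    cuspCoeff cuspFormEtaProductTwentySeven n = (((⟨0, 0, 1, 0, 0⟩ : WeierstrassCurve ℚ).LFunction n : ℤ) : ℂ) := by
  obtain ⟨g, hg⟩ := existsNewform_twentySevenA3
  rw [← NonVacuityTwentySeven.eq_etaProductTwentySeven_of_isNewform0 hg.1]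
  exact hg.2 n

/-- **`η(3τ)²η(9τ)²` is the newform of `27a3 : y² + y = x³`** (`IsNewformOf`, FACT-FREE — the second explicit modularity instance in the tree after
`η(4τ)²η(8τ)² ↔ y² = x³ − x`). [cite: Koehler2011, §1] [cite: CremonaAlgorithms1997, Table 1 (27a3), Table 3] -/
theorem isNewformOf_twentySevenA3_etaProduct : IsNewformOf (⟨0, 0, 1, 0, 0⟩ : WeierstrassCurve ℚ) cuspFormEtaProductTwentySeven :=
  NonVacuityTwentySeven.isNewformOf_etaProductTwentySeven_of_cuspCoeff_eq cuspCoeff_etaProductTwentySeven_eq_lFunction_twentySevenA3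

/-- **The classical identity `η(3τ)²η(9τ)² = Σ_{(𝔞,3)=1} ϖ_𝔞 q^{N𝔞}`** (the `η`-product is Hecke's theta series of `ℚ(ω)` mod `(3)`), coefficientwise,
FACT-FREE. [cite: Koehler2011, §1] [cite: Hecke1926Modulfunktionen] -/
theorem cuspCoeff_etaProductTwentySeven_eq_heckeSum (n : ℕ) :
    cuspCoeff cuspFormEtaProductTwentySeven n = ∑ I ∈ idealsOfNorm K3 n, grossenNu (1 : 𝓞 K3) 1 0 I * embC (primGen I : K3) := by
  rw [cuspCoeff_etaProductTwentySeven_eq_lFunction_twentySevenA3, lFunction_twentySevenA3_eq_heckeSum]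

/-! ## §6 THE WITNESS: a lattice-optimal minimal `X₀(27)`-datum exists, UNCONDITIONALLY (E-an-g48-2) -/

/-- **E-an-g48-2 PROVED (fact-free): a lattice-optimal `X₀(27)`-datum of a global minimal curve in the isogeny class `27a` EXISTS**, with newform
`η(3τ)²η(9τ)²` (p3's plug `exists_latticeOptimalDatum_twentySeven_of_cuspCoeff_eq`, discharged by §5). [cite: Hecke1926Modulfunktionen] [cite: EdixhovenManin1991, Prop. 2] -/
theorem exists_latticeOptimalDatum_twentySeven :
    ∃ (W₀ : WeierstrassCurve ℚ) (_ : W₀.IsElliptic) (_ : W₀.IsGloballyMinimal) (D₀ : ModularParametrizationData W₀ 27),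
      D₀.f = cuspFormEtaProductTwentySeven ∧ (⟨0, 0, 1, 0, 0⟩ : WeierstrassCurve ℚ).IsIsogenous W₀ ∧
        ∀ z ∈ D₀.L.lattice, ∃ w ∈ periodLattice D₀.f, z = D₀.c * w := by
  haveI : (⟨0, 0, 1, 0, 0⟩ : WeierstrassCurve ℚ).IsElliptic :=
    ⟨by norm_num [WeierstrassCurve.Δ, WeierstrassCurve.b₂, WeierstrassCurve.b₄, WeierstrassCurve.b₆, WeierstrassCurve.b₈]⟩
  exact NonVacuityTwentySeven.exists_latticeOptimalDatum_twentySeven_of_cuspCoeff_eq _ cuspCoeff_etaProductTwentySeven_eq_lFunction_twentySevenA3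

/-- **C3's ∀-DOMAIN IS INHABITED AT `N = 27`, UNCONDITIONALLY** (literally C3's binder block: globally minimal `W₀`, `X₀(N)`-datum with the lattice
clause, `3² ∣ N`; the first inhabitant with `27 ∣ N`). [cite: Hecke1926Modulfunktionen] [cite: EdixhovenManin1991, Prop. 2] -/
theorem maninPrimeToThreeAtNine_domain_inhabited_twentySeven :
    ∃ (W₀ : WeierstrassCurve ℚ) (_ : W₀.IsElliptic) (_ : W₀.IsGloballyMinimal) (D₀ : ModularParametrizationData W₀ 27),
      (∀ z ∈ D₀.L.lattice, ∃ w ∈ periodLattice D₀.f, z = D₀.c * w) ∧ 3 ^ 2 ∣ 27 := by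
  haveI : (⟨0, 0, 1, 0, 0⟩ : WeierstrassCurve ℚ).IsElliptic :=
    ⟨by norm_num [WeierstrassCurve.Δ, WeierstrassCurve.b₂, WeierstrassCurve.b₄, WeierstrassCurve.b₆, WeierstrassCurve.b₈]⟩
  exact NonVacuityTwentySeven.maninPrimeToThreeAtNine_domain_inhabited_of_cuspCoeff_eq _ cuspCoeff_etaProductTwentySeven_eq_lFunction_twentySevenA3

/-- **BCDT-modularity of `27a3` at its conductor level, unconditionally**: for `M = N(27a3)` (`= 27`, p3's kernel certificate
`LevelTwentySeven.conductorNorm_twentySevenA3`) there is a newform of `27a3` in `S₂(Γ₀(M))`. [cite: Hecke1926Modulfunktionen] [cite: CremonaAlgorithms1997, Table 1 (27a3)] -/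
theorem exists_isNewformOf_twentySevenA3 (M : ℕ) [NeZero M] (hM : (⟨0, 0, 1, 0, 0⟩ : WeierstrassCurve ℚ).conductorNorm ℤ = M) :
    ∃ f : CuspForm (Gamma0 M) 2, IsNewformOf (⟨0, 0, 1, 0, 0⟩ : WeierstrassCurve ℚ) f := by
  have h27 : M = 27 := by rw [← hM, LevelTwentySeven.conductorNorm_twentySevenA3]
  subst h27
  exact ⟨_, isNewformOf_twentySevenA3_etaProduct⟩

/-! ## §7 The route's conditional statements SAY SOMETHING at `27 ∣ N` -/

/-- The rung `ManinConstantOneRung` ⟹ `|c₀| = 1` for a lattice-optimal `X₀(27)`-datum (inhabited instance at the additive level `3³`).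
CONDITIONAL on the rung (= Manin's conjecture, open). [cite: EdixhovenManin1991, Prop. 2] -/
theorem abs_maninConstant_eq_one_twentySeven_of_rung (h : Theses.ManinLocalTwoThree.ManinConstantOneRung) :
    ∃ (W₀ : WeierstrassCurve ℚ) (_ : W₀.IsElliptic) (_ : W₀.IsGloballyMinimal) (D₀ : ModularParametrizationData W₀ 27),
      (⟨0, 0, 1, 0, 0⟩ : WeierstrassCurve ℚ).IsIsogenous W₀ ∧ |D₀.maninConstant| = 1 := by
  haveI : NeZero (27 : ℕ) := ⟨by decide⟩
  obtain ⟨W₀, hE₀, hM₀, D₀, -, hiso, hopt⟩ := exists_latticeOptimalDatum_twentySeven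
  haveI := hE₀; haveI := hM₀
  exact ⟨W₀, hE₀, hM₀, D₀, hiso, h W₀ D₀ hopt⟩

/-- **Item C3 `ManinPrimeToThreeAtNine` (under its four displayed Literature binders) ⟹ `3 ∤ c₀` for a lattice-optimal `X₀(27)`-datum**: the first
inhabited instance of the `9 ∣ N` clause at `27 ∣ N`.  CONDITIONAL on the item (open) and its binders. [cite: EdixhovenManin1991, Prop. 2] -/
theorem not_three_dvd_maninConstant_twentySeven_of_C3 (h : Theses.ManinLocalTwoThree.ManinPrimeToThreeAtNine)
    (h₁ : mazur_not_dvd_maninConstant_of_odd) (h₂ : abbesUllmo_not_dvd_maninConstant_of_not_dvd_level)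
    (h₃ : cesnavicius_not_two_dvd_maninConstant_of_two_dvd_level) (h₄ : exists_isNewformOf) :
    ∃ (W₀ : WeierstrassCurve ℚ) (_ : W₀.IsElliptic) (_ : W₀.IsGloballyMinimal) (D₀ : ModularParametrizationData W₀ 27),
      (⟨0, 0, 1, 0, 0⟩ : WeierstrassCurve ℚ).IsIsogenous W₀ ∧ ¬ (3 : ℤ) ∣ D₀.maninConstant := by
  haveI : NeZero (27 : ℕ) := ⟨by decide⟩
  obtain ⟨W₀, hE₀, hM₀, D₀, -, hiso, hopt⟩ := exists_latticeOptimalDatum_twentySeven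
  haveI := hE₀; haveI := hM₀
  exact ⟨W₀, hE₀, hM₀, D₀, hiso, h h₁ h₂ h₃ h₄ W₀ D₀ hopt ⟨3, by norm_num⟩⟩

/-- **Under CDT ALONE: a lattice-optimal `X₀(27)`-datum with `3 ∤ c₀` EXISTS** (fact-free existence §6 + the cell's per-datum C3 ⟸ CDT
`NonVacuityTwentySeven.not_three_dvd_maninConstant_twentySeven_of_CDT`; no modularity binder).  CONDITIONAL on CDT (printed, statement-only).
[cite: CalegariDimitrovTang2025, Thm. 1] -/
theorem exists_datum_twentySeven_not_three_dvd_of_CDT (hCDT : CalegariDimitrovTang2025_unboundedDenominators) :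
    ∃ (W₀ : WeierstrassCurve ℚ) (_ : W₀.IsElliptic) (_ : W₀.IsGloballyMinimal) (D₀ : ModularParametrizationData W₀ 27),
      (∀ z ∈ D₀.L.lattice, ∃ w ∈ periodLattice D₀.f, z = D₀.c * w) ∧ ¬ (3 : ℤ) ∣ D₀.maninConstant := by
  haveI : NeZero (27 : ℕ) := ⟨by decide⟩
  obtain ⟨W₀, hE₀, hM₀, D₀, -, -, hopt⟩ := exists_latticeOptimalDatum_twentySeven
  haveI := hE₀; haveI := hM₀
  exact ⟨W₀, hE₀, hM₀, D₀, hopt, NonVacuityTwentySeven.not_three_dvd_maninConstant_twentySeven_of_CDT hCDT W₀ D₀ hopt⟩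

end Summit.BirchSwinnertonDyer.BirchSwinnertonDyer.Theorems.ManinLocalTwoThree.HeckeThetaTwentySeven

end
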